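import Mathlib
import HarnessLib
import Summits.KontsevichZagierPeriods.KontsevichZagierPeriods.Theorems.SoloInformedLogRoomCore
import Summits.KontsevichZagierPeriods.KontsevichZagierPeriods.Theorems.SoloInformedLogRoomEndpoint
import Summits.KontsevichZagierPeriods.KontsevichZagierPeriods.Theorems.SoloInformedLogRoomLeftRight

/-!
# SoloInformed — log-room estimates IV: the one-variable log-room lemma, bounded fibre (LEMMA I programme, file F1d)

Solo programme `solo-KontsevichZagierPeriods-informed`, session s140; assembles files F1a–F1c
into the ONE-VARIABLE LOG-ROOM LEMMA on a bounded fibre, in the form consumed by the log-room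
theorem (file F4): `soloInformed_logRoom_Ioo` — for `0 ≤ α₀ < β₀`, `d ∉ (α₀, β₀)`, `K ≥ 0`,
`∫⁻_{(α₀,β₀)} u^r (K + |log |u-d||)^p ≤ C(r,p) Λ^p ∫⁻_{(α₀,β₀)} u^r` with
`Λ = 1 + K + log⁺|d| + log⁺ β₀ + log⁺ β₀⁻¹ + log⁺ α₀⁻¹ + log⁺ (β₀-α₀)⁻¹`.

In a prepared band (Lion–Rolin) the integrand is `≍ |a(x)| u^r` in the normal variable
`u = |y - θ(x)|`, a second prepared function contributes `|log ρ| ≤ K(x) + |r₁| |log|u - d(x)||`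
with `d(x) = ±(θ₁(x) - θ(x)) ∉` fibre, and the lemma bounds the fibre log-moment by `Λ(x)^p` times
the fibre mass, `Λ` being `1 +` a sum of `log⁺` of semialgebraic data — the input of the induction
on the fibre dimension.  References: J.-M. Lion, J.-P. Rolin, Ann. Inst. Fourier 48 (1998) 755–767,
§1; G. Comte, J.-M. Lion, J.-P. Rolin, Illinois J. Math. 44 (2000) 884–888, Thm. 3.
-/

noncomputable section

open scoped ENNReal
open MeasureTheory Set Real

namespace Summit.KontsevichZagierPeriods.KontsevichZagierPeriods.Theorems

/-! ### Measurability and pointwise reductions -/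

/-- `log⁺` is measurable. [cite: LionRolin1998, §1] -/
theorem soloInformed_measurable_posLog : Measurable fun x : ℝ => log⁺ x :=
  Real.continuous_posLog.measurable

/-- Measurability of `u ↦ ofReal (A u^r (log⁺ (g u)⁻¹)^p)` for measurable `g`.
[cite: LionRolin1998, §1] -/
theorem soloInformed_measurable_weight_posLog {g : ℝ → ℝ} (hg : Measurable g) (A r : ℝ) (p : ℕ) :
    Measurable fun u : ℝ => ENNReal.ofReal (A * u ^ r * (log⁺ (g u)⁻¹) ^ p) :=
  (((measurable_const.mul (measurable_id.pow_const r))).mul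
    ((soloInformed_measurable_posLog.comp hg.inv).pow_const p)).ennreal_ofReal

/-- `log⁺ |u - d| ≤ 1 + log⁺ u + log⁺ |d|` for `0 ≤ u`. [cite: LionRolin1998, §1] -/
theorem soloInformed_posLog_abs_sub_le {u d : ℝ} (hu : 0 ≤ u) :
    log⁺ |u - d| ≤ 1 + log⁺ u + log⁺ |d| := by
  have h1 : |u - d| ≤ u + |d| := by
    calc |u - d| ≤ |u| + |d| := abs_sub u d
      _ = u + |d| := by rw [abs_of_nonneg hu]
  calc log⁺ |u - d| ≤ log⁺ (u + |d|) := Real.posLog_le_posLog (abs_nonneg _) h1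
    _ ≤ Real.log 2 + log⁺ u + log⁺ |d| := Real.posLog_add
    _ ≤ 1 + log⁺ u + log⁺ |d| := by
        linarith [Real.log_le_sub_one_of_pos (by norm_num : (0 : ℝ) < 2)]

/-- Pointwise reduction on a bounded fibre: for `u ∈ (α₀, β₀)`, `0 ≤ α₀`, `d ∉ (α₀, β₀)`,
`|log |u-d|| ≤ (1 + log⁺ β₀ + log⁺ |d|) + log⁺ (u-α₀)⁻¹ + log⁺ (β₀-u)⁻¹`.
[cite: LionRolin1998, §1] -/
theorem soloInformed_abs_log_abs_sub_le_Ioo {α₀ β₀ d u : ℝ} (hα : 0 ≤ α₀) (hu : u ∈ Ioo α₀ β₀)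
    (hd : d ≤ α₀ ∨ β₀ ≤ d) :
    |Real.log (|u - d|)| ≤ (1 + log⁺ β₀ + log⁺ |d|) + log⁺ (u - α₀)⁻¹ + log⁺ (β₀ - u)⁻¹ := by
  have hu0 : 0 ≤ u := hα.trans hu.1.le
  have hA : 0 ≤ log⁺ (u - α₀)⁻¹ := Real.posLog_nonneg
  have hB : 0 ≤ log⁺ (β₀ - u)⁻¹ := Real.posLog_nonneg
  have h1 := soloInformed_abs_log_le_posLog |u - d|
  have h2 : log⁺ |u - d| ≤ 1 + log⁺ β₀ + log⁺ |d| := by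
    have := soloInformed_posLog_abs_sub_le (d := d) hu0
    have h3 : log⁺ u ≤ log⁺ β₀ := Real.posLog_le_posLog hu0 hu.2.le
    linarith
  have h3 : log⁺ |u - d|⁻¹ ≤ log⁺ (u - α₀)⁻¹ + log⁺ (β₀ - u)⁻¹ := by
    rcases hd with hd | hd
    · have : log⁺ |u - d|⁻¹ ≤ log⁺ (u - α₀)⁻¹ :=
        soloInformed_posLog_inv_antitone (by linarith [hu.1]) (by
          rw [abs_of_nonneg (by linarith [hu.1])]; linarith)
      linarith
    · have : log⁺ |u - d|⁻¹ ≤ log⁺ (β₀ - u)⁻¹ :=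
        soloInformed_posLog_inv_antitone (by linarith [hu.2]) (by
          rw [abs_of_nonpos (by linarith [hu.2])]; linarith)
      linarith
  linarith

/-! ### The one-variable log-room lemma, bounded fibre -/

/-- ONE-VARIABLE LOG-ROOM LEMMA (bounded fibre). For every `r` and `p` there is `C ≥ 1` such that
for all `0 ≤ α₀ < β₀`, `d ∉ (α₀, β₀)` and `K ≥ 0`:
`∫⁻_{(α₀,β₀)} u^r (K + |log |u-d||)^p ≤ C Λ^p ∫⁻_{(α₀,β₀)} u^r`,
`Λ = 1 + K + log⁺|d| + log⁺ β₀ + log⁺ β₀⁻¹ + log⁺ α₀⁻¹ + log⁺ (β₀-α₀)⁻¹`. [cite: LionRolin1998, §1] -/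
theorem soloInformed_logRoom_Ioo (r : ℝ) (p : ℕ) :
    ∃ C : ℝ, 1 ≤ C ∧ ∀ (α₀ β₀ d K : ℝ), 0 ≤ α₀ → α₀ < β₀ → (d ≤ α₀ ∨ β₀ ≤ d) → 0 ≤ K →
      ∫⁻ u in Ioo α₀ β₀, ENNReal.ofReal (u ^ r * (K + |Real.log (|u - d|)|) ^ p) ≤
        ENNReal.ofReal (C * (1 + K + log⁺ |d| + log⁺ β₀ + log⁺ β₀⁻¹ + log⁺ α₀⁻¹ +
          log⁺ (β₀ - α₀)⁻¹) ^ p) * ∫⁻ u in Ioo α₀ β₀, ENNReal.ofReal (u ^ r) := by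
  rcases Nat.eq_zero_or_pos p with hp | hp
  · subst hp
    refine ⟨1, le_rfl, fun α₀ β₀ d K _ _ _ _ => ?_⟩
    simp only [pow_zero, mul_one, ENNReal.ofReal_one, one_mul, le_refl]
  obtain ⟨C₀, hC₀, h₀⟩ := soloInformed_logRoom_origin r hp
  obtain ⟨C₁, hC₁, h₁⟩ := soloInformed_logRoom_leftEndpoint_gen r hp
  obtain ⟨C₂, hC₂, h₂⟩ := soloInformed_logRoom_rightEndpoint_gen r hp
  refine ⟨4 ^ p * (1 + C₀ + C₁ + 2 ^ p * C₂), ?_, ?_⟩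
  · have h4 : (1 : ℝ) ≤ 4 ^ p := one_le_pow₀ (by norm_num)
    have : (1 : ℝ) ≤ 1 + C₀ + C₁ + 2 ^ p * C₂ := by
      have : (0 : ℝ) ≤ 2 ^ p * C₂ := by positivity
      linarith
    exact one_le_mul_of_one_le_of_one_le h4 this
  intro α₀ β₀ d K hα hαβ hd hK
  set J := Ioo α₀ β₀ with hJ_def
  set I := ∫⁻ u in J, ENNReal.ofReal (u ^ r) with hI_def
  set Λ : ℝ := 1 + K + log⁺ |d| + log⁺ β₀ + log⁺ β₀⁻¹ + log⁺ α₀⁻¹ + log⁺ (β₀ - α₀)⁻¹ with hΛ_def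
  have hβ : 0 < β₀ := lt_of_le_of_lt hα hαβ
  have hl1 : 0 ≤ log⁺ |d| := Real.posLog_nonneg
  have hl2 : 0 ≤ log⁺ β₀ := Real.posLog_nonneg
  have hl3 : 0 ≤ log⁺ β₀⁻¹ := Real.posLog_nonneg
  have hl4 : 0 ≤ log⁺ α₀⁻¹ := Real.posLog_nonneg
  have hl5 : 0 ≤ log⁺ (β₀ - α₀)⁻¹ := Real.posLog_nonneg
  have hΛ1 : 1 ≤ Λ := by rw [hΛ_def]; linarith
  have hΛ0 : 0 ≤ Λ := zero_le_one.trans hΛ1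
  -- the constant part
  set K₁ : ℝ := 1 + log⁺ β₀ + log⁺ |d| + K with hK₁_def
  have hK₁ : 0 ≤ K₁ := by rw [hK₁_def]; linarith
  have hK₁Λ : K₁ ≤ Λ := by rw [hK₁_def, hΛ_def]; linarith
  -- pointwise: `u^r (K + |log|u-d||)^p ≤ 4^p K₁^p u^r + 4^p u^r A^p + 4^p u^r B^p`
  have hpt : ∀ u ∈ J, ENNReal.ofReal (u ^ r * (K + |Real.log (|u - d|)|) ^ p) ≤
      ENNReal.ofReal (4 ^ p * K₁ ^ p * u ^ r) +
        ENNReal.ofReal (4 ^ p * u ^ r * (log⁺ (u - α₀)⁻¹) ^ p) +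
        ENNReal.ofReal (4 ^ p * u ^ r * (log⁺ (β₀ - u)⁻¹) ^ p) := by
    intro u hu
    have hu0 : 0 ≤ u := hα.trans hu.1.le
    have hur : 0 ≤ u ^ r := Real.rpow_nonneg hu0 r
    have hA : 0 ≤ log⁺ (u - α₀)⁻¹ := Real.posLog_nonneg
    have hB : 0 ≤ log⁺ (β₀ - u)⁻¹ := Real.posLog_nonneg
    have hred := soloInformed_abs_log_abs_sub_le_Ioo hα hu hd
    have hsum : K + |Real.log (|u - d|)| ≤ K₁ + log⁺ (u - α₀)⁻¹ + log⁺ (β₀ - u)⁻¹ := by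
      rw [hK₁_def]; linarith
    have h0 : 0 ≤ K + |Real.log (|u - d|)| := add_nonneg hK (abs_nonneg _)
    have h3 := (pow_le_pow_left₀ h0 hsum p).trans (soloInformed_add_add_pow_le p hK₁ hA hB)
    rw [← ENNReal.ofReal_add (by positivity) (by positivity),
      ← ENNReal.ofReal_add (by positivity) (by positivity)]
    apply ENNReal.ofReal_le_ofReal
    calc u ^ r * (K + |Real.log (|u - d|)|) ^ p
        ≤ u ^ r * (4 ^ p * (K₁ ^ p + (log⁺ (u - α₀)⁻¹) ^ p + (log⁺ (β₀ - u)⁻¹) ^ p)) :=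
          mul_le_mul_of_nonneg_left h3 hur
      _ = _ := by ring
  -- the three integrals
  have hIA : ∫⁻ u in J, ENNReal.ofReal (4 ^ p * u ^ r * (log⁺ (u - α₀)⁻¹) ^ p) ≤
      ENNReal.ofReal (4 ^ p * (C₀ + C₁) * Λ ^ p) * I := by
    have hrw : ∫⁻ u in J, ENNReal.ofReal (4 ^ p * u ^ r * (log⁺ (u - α₀)⁻¹) ^ p) =
        ENNReal.ofReal (4 ^ p) * ∫⁻ u in J, ENNReal.ofReal (u ^ r * (log⁺ (u - α₀)⁻¹) ^ p) := by
      rw [← soloInformed_setLIntegral_ofReal_const_mul (by positivity)]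
      congr 1 with u; congr 1; ring
    rw [hrw]
    rcases hα.eq_or_lt with hα0 | hα0
    · -- `α₀ = 0`: the origin lemma
      have hJ0 : J = Ioo 0 β₀ := by rw [hJ_def, ← hα0]
      have := h₀ β₀ hβ
      have hΛ' : 1 + log⁺ β₀⁻¹ ≤ Λ := by rw [hΛ_def]; linarith
      have hΛ'0 : 0 ≤ 1 + log⁺ β₀⁻¹ := add_nonneg zero_le_one Real.posLog_nonneg
      calc ENNReal.ofReal (4 ^ p) * ∫⁻ u in J, ENNReal.ofReal (u ^ r * (log⁺ (u - α₀)⁻¹) ^ p)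
          = ENNReal.ofReal (4 ^ p) * ∫⁻ u in Ioo 0 β₀, ENNReal.ofReal (u ^ r * (log⁺ u⁻¹) ^ p) := by
            rw [hJ0, ← hα0]; simp only [sub_zero]
        _ ≤ ENNReal.ofReal (4 ^ p) * (ENNReal.ofReal (C₀ * (1 + log⁺ β₀⁻¹) ^ p) *
              ∫⁻ u in Ioo 0 β₀, ENNReal.ofReal (u ^ r)) := by gcongr
        _ = ENNReal.ofReal (4 ^ p * (C₀ * (1 + log⁺ β₀⁻¹) ^ p)) * I := by
            rw [ENNReal.ofReal_mul (p := 4 ^ p) (by positivity), mul_assoc, hI_def, hJ0]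
        _ ≤ ENNReal.ofReal (4 ^ p * (C₀ + C₁) * Λ ^ p) * I := by
            refine mul_le_mul_of_nonneg_right (ENNReal.ofReal_le_ofReal ?_) zero_le
            calc 4 ^ p * (C₀ * (1 + log⁺ β₀⁻¹) ^ p) ≤ 4 ^ p * (C₀ * Λ ^ p) := by gcongr
              _ ≤ 4 ^ p * ((C₀ + C₁) * Λ ^ p) := by
                  gcongr; linarith
              _ = 4 ^ p * (C₀ + C₁) * Λ ^ p := by ring
    · -- `α₀ > 0`: the left-endpoint lemma with scale `L = min (β₀ - α₀) (min α₀ 1)`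
      set L : ℝ := min (β₀ - α₀) (min α₀ 1) with hL_def
      have hL : 0 < L := lt_min (by linarith) (lt_min hα0 one_pos)
      have hLα : L ≤ α₀ := (min_le_right _ _).trans (min_le_left _ _)
      have hL1 : L ≤ 1 := (min_le_right _ _).trans (min_le_right _ _)
      have hLβ : L ≤ β₀ - α₀ := min_le_left _ _
      have hTJ : Ioo α₀ (α₀ + L) ⊆ J := Ioo_subset_Ioo le_rfl (by linarith)
      have hJI : J ⊆ Ioi α₀ := fun u hu => hu.1
      have := h₁ α₀ L J hα0 hL hLα hL1 measurableSet_Ioo hTJ hJI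
      have hΛ' : 1 + log⁺ L⁻¹ ≤ Λ := by
        have h1 : log⁺ L⁻¹ ≤ log⁺ (β₀ - α₀)⁻¹ + log⁺ (min α₀ 1)⁻¹ := soloInformed_posLog_inv_min_le _ _
        have h2 : log⁺ (min α₀ 1)⁻¹ ≤ log⁺ α₀⁻¹ + log⁺ (1 : ℝ)⁻¹ := soloInformed_posLog_inv_min_le _ _
        have h3 : log⁺ (1 : ℝ)⁻¹ = 0 := by
          rw [inv_one]; exact soloInformed_posLog_eq_zero_of_le_one zero_le_one le_rfl
        rw [hΛ_def]; linarith
      have hL0 : 0 ≤ 1 + log⁺ L⁻¹ := add_nonneg zero_le_one Real.posLog_nonneg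
      calc ENNReal.ofReal (4 ^ p) * ∫⁻ u in J, ENNReal.ofReal (u ^ r * (log⁺ (u - α₀)⁻¹) ^ p)
          ≤ ENNReal.ofReal (4 ^ p) * (ENNReal.ofReal (C₁ * (1 + log⁺ L⁻¹) ^ p) * I) := by gcongr
        _ = ENNReal.ofReal (4 ^ p * (C₁ * (1 + log⁺ L⁻¹) ^ p)) * I := by
            rw [ENNReal.ofReal_mul (p := 4 ^ p) (by positivity), mul_assoc]
        _ ≤ ENNReal.ofReal (4 ^ p * (C₀ + C₁) * Λ ^ p) * I := by
            refine mul_le_mul_of_nonneg_right (ENNReal.ofReal_le_ofReal ?_) zero_le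
            have hC₁0 : 0 ≤ C₁ := zero_le_one.trans hC₁
            calc 4 ^ p * (C₁ * (1 + log⁺ L⁻¹) ^ p) ≤ 4 ^ p * (C₁ * Λ ^ p) := by gcongr
              _ ≤ 4 ^ p * ((C₀ + C₁) * Λ ^ p) := by gcongr; linarith
              _ = 4 ^ p * (C₀ + C₁) * Λ ^ p := by ring
  have hIB : ∫⁻ u in J, ENNReal.ofReal (4 ^ p * u ^ r * (log⁺ (β₀ - u)⁻¹) ^ p) ≤
      ENNReal.ofReal (4 ^ p * (2 ^ p * C₂) * Λ ^ p) * I := by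
    have hrw : ∫⁻ u in J, ENNReal.ofReal (4 ^ p * u ^ r * (log⁺ (β₀ - u)⁻¹) ^ p) =
        ENNReal.ofReal (4 ^ p) * ∫⁻ u in J, ENNReal.ofReal (u ^ r * (log⁺ (β₀ - u)⁻¹) ^ p) := by
      rw [← soloInformed_setLIntegral_ofReal_const_mul (by positivity)]
      congr 1 with u; congr 1; ring
    rw [hrw]
    set L : ℝ := min (β₀ - α₀) (min (β₀ / 2) 1) with hL_def
    have hL : 0 < L := lt_min (by linarith) (lt_min (by positivity) one_pos)
    have hLb : L ≤ β₀ / 2 := (min_le_right _ _).trans (min_le_left _ _)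
    have hL1 : L ≤ 1 := (min_le_right _ _).trans (min_le_right _ _)
    have hLβ : L ≤ β₀ - α₀ := min_le_left _ _
    have hTJ : Ioo (β₀ - L) β₀ ⊆ J := Ioo_subset_Ioo (by linarith) le_rfl
    have hJI : J ⊆ Ioo 0 β₀ := Ioo_subset_Ioo hα le_rfl
    have := h₂ β₀ L J hβ hL hLb hL1 measurableSet_Ioo hTJ hJI
    have hΛ' : 1 + log⁺ L⁻¹ ≤ 2 * Λ := by
      have h1 : log⁺ L⁻¹ ≤ log⁺ (β₀ - α₀)⁻¹ + log⁺ (min (β₀ / 2) 1)⁻¹ :=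
        soloInformed_posLog_inv_min_le _ _
      have h2 : log⁺ (min (β₀ / 2) 1)⁻¹ ≤ log⁺ (β₀ / 2)⁻¹ + log⁺ (1 : ℝ)⁻¹ :=
        soloInformed_posLog_inv_min_le _ _
      have h3 : log⁺ (1 : ℝ)⁻¹ = 0 := by
        rw [inv_one]; exact soloInformed_posLog_eq_zero_of_le_one zero_le_one le_rfl
      have h4 : log⁺ (β₀ / 2)⁻¹ ≤ 1 + log⁺ β₀⁻¹ := by
        have : (β₀ / 2)⁻¹ = 2 * β₀⁻¹ := by rw [inv_div]; ring
        rw [this]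
        calc log⁺ (2 * β₀⁻¹) ≤ log⁺ 2 + log⁺ β₀⁻¹ := Real.posLog_mul
          _ ≤ 1 + log⁺ β₀⁻¹ := by
              rw [soloInformed_posLog_eq_log_of_one_le (by norm_num : (1 : ℝ) ≤ 2)]
              linarith [Real.log_le_sub_one_of_pos (by norm_num : (0 : ℝ) < 2)]
      rw [hΛ_def]; linarith
    have h2Λ : (1 + log⁺ L⁻¹) ^ p ≤ 2 ^ p * Λ ^ p := by
      rw [← mul_pow]; exact pow_le_pow_left₀ (add_nonneg zero_le_one Real.posLog_nonneg) hΛ' p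
    calc ENNReal.ofReal (4 ^ p) * ∫⁻ u in J, ENNReal.ofReal (u ^ r * (log⁺ (β₀ - u)⁻¹) ^ p)
        ≤ ENNReal.ofReal (4 ^ p) * (ENNReal.ofReal (C₂ * (1 + log⁺ L⁻¹) ^ p) * I) := by gcongr
      _ = ENNReal.ofReal (4 ^ p * (C₂ * (1 + log⁺ L⁻¹) ^ p)) * I := by
          rw [ENNReal.ofReal_mul (p := 4 ^ p) (by positivity), mul_assoc]
      _ ≤ ENNReal.ofReal (4 ^ p * (2 ^ p * C₂) * Λ ^ p) * I := by
          refine mul_le_mul_of_nonneg_right (ENNReal.ofReal_le_ofReal ?_) zero_le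
          have hC₂0 : 0 ≤ C₂ := zero_le_one.trans hC₂
          calc 4 ^ p * (C₂ * (1 + log⁺ L⁻¹) ^ p) ≤ 4 ^ p * (C₂ * (2 ^ p * Λ ^ p)) := by gcongr
            _ = 4 ^ p * (2 ^ p * C₂) * Λ ^ p := by ring
  have hIK : ∫⁻ u in J, ENNReal.ofReal (4 ^ p * K₁ ^ p * u ^ r) ≤ ENNReal.ofReal (4 ^ p * 1 * Λ ^ p) * I := by
    rw [soloInformed_setLIntegral_ofReal_const_mul (by positivity)]
    refine mul_le_mul_of_nonneg_right (ENNReal.ofReal_le_ofReal ?_) zero_le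
    rw [mul_one]
    exact mul_le_mul_of_nonneg_left (pow_le_pow_left₀ hK₁ hK₁Λ p) (by positivity)
  -- assemble
  have hmeas1 : Measurable fun u : ℝ => ENNReal.ofReal (4 ^ p * K₁ ^ p * u ^ r) :=
    soloInformed_measurable_ofReal_const_mul_rpow _ r
  have hmeas2 : Measurable fun u : ℝ => ENNReal.ofReal (4 ^ p * u ^ r * (log⁺ (u - α₀)⁻¹) ^ p) :=
    soloInformed_measurable_weight_posLog (measurable_id.sub_const α₀) _ r p
  have hmeas12 : Measurable fun u : ℝ => ENNReal.ofReal (4 ^ p * K₁ ^ p * u ^ r) +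
      ENNReal.ofReal (4 ^ p * u ^ r * (log⁺ (u - α₀)⁻¹) ^ p) := hmeas1.add hmeas2
  calc ∫⁻ u in J, ENNReal.ofReal (u ^ r * (K + |Real.log (|u - d|)|) ^ p)
      ≤ ∫⁻ u in J, (ENNReal.ofReal (4 ^ p * K₁ ^ p * u ^ r) +
          ENNReal.ofReal (4 ^ p * u ^ r * (log⁺ (u - α₀)⁻¹) ^ p) +
          ENNReal.ofReal (4 ^ p * u ^ r * (log⁺ (β₀ - u)⁻¹) ^ p)) := setLIntegral_mono' measurableSet_Ioo hpt
    _ = (∫⁻ u in J, ENNReal.ofReal (4 ^ p * K₁ ^ p * u ^ r)) +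
          (∫⁻ u in J, ENNReal.ofReal (4 ^ p * u ^ r * (log⁺ (u - α₀)⁻¹) ^ p)) +
          ∫⁻ u in J, ENNReal.ofReal (4 ^ p * u ^ r * (log⁺ (β₀ - u)⁻¹) ^ p) := by
        rw [lintegral_add_left hmeas12, lintegral_add_left hmeas1]
    _ ≤ ENNReal.ofReal (4 ^ p * 1 * Λ ^ p) * I + ENNReal.ofReal (4 ^ p * (C₀ + C₁) * Λ ^ p) * I +
          ENNReal.ofReal (4 ^ p * (2 ^ p * C₂) * Λ ^ p) * I := by
        gcongr
    _ = ENNReal.ofReal (4 ^ p * (1 + C₀ + C₁ + 2 ^ p * C₂) * Λ ^ p) * I := by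
        have hC₀0 : 0 ≤ C₀ := zero_le_one.trans hC₀
        have hC₁0 : 0 ≤ C₁ := zero_le_one.trans hC₁
        have hC₂0 : 0 ≤ C₂ := zero_le_one.trans hC₂
        rw [← add_mul, ← add_mul, ← ENNReal.ofReal_add (by positivity) (by positivity),
          ← ENNReal.ofReal_add (by positivity) (by positivity)]
        congr 2; ring

end Summit.KontsevichZagierPeriods.KontsevichZagierPeriods.Theorems
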